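import Summits.MatrixMultiplication.MatrixMultiplication.Theorems.AbelianSTPPCensusTAStatBDefs

/-!
# T_A certificate, second range `5001 … 5666` (static t*-indexed linear checker): kernel evaluation, domination of the table, volumes `929 … 1642`

Cell mm-stpp (rung F-M1), threshold T_A = `τ = 2.371`; checker in `AbelianSTPPCensusTAStatBDefs.lean`, table in `AbelianSTPPCensusTAStatBData.lean`.
`decide` with kernel reduction (standard axioms; no `native_decide`), `Elab.async false`; consumed by `TAStatB.checkV_sound` / `TAStatB.domV_sound`
in the leaf `AbelianSTPPCensusLeafTA5666Closed.lean`.  (Two domination chunks per file: the 90 × 99 table makes each row walk longer than in the first range.)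
WHAT THIS IS NOT: arithmetic on shape lists only; no statement about STPP families or `ω`.
-/

set_option linter.dupNamespace false
set_option autoImplicit false
set_option Elab.async false

namespace Summit.MatrixMultiplication.MatrixMultiplication.Theorems.TAStatB

set_option maxHeartbeats 0 in
/-- Domination chunk: every sorted candidate shape of the volumes `929 … 1296` (2637 shapes) is dominated by the table (`domX`). [original] -/
theorem dom929 : TAStatB.domV 368 929 = true := by decide +kernel

set_option maxHeartbeats 0 in
/-- Domination chunk: every sorted candidate shape of the volumes `1297 … 1642` (2600 shapes) is dominated by the table (`domX`). [original] -/
theorem dom1297 : TAStatB.domV 346 1297 = true := by decide +kernel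

end Summit.MatrixMultiplication.MatrixMultiplication.Theorems.TAStatB
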